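import Summits.QuantumFields.YangMills.Theorems.UnitScaleTiltFluctuationComparisonRegPrAnsatzTTerms

/-!
# Route `UnitScaleTilt` — crux K1bR-pr `FluctuationComparisonRegPrL` (stmt-QuantumFields-19935, ex 19201), stub `stub_oneStepSmallLift`
# (W7 line), «ANSATZ T» part 3c — THE ROW BOUND OF THE TENSOR TABLE, orientation `(0,1)`: the first-order plaquette functional equals
# `J₂ − H₂∘d₂` EXACTLY (chain identities of part 1b), hence `≤ (18/L²)·B_w + 1·B_d` (support file `--supports stmt-QuantumFields-19935`)

Cell `ym3-torus` (rung R3), seat `ym3-torus-p2` gen 10 (IR-NODE §16: `F₀ + d₁Z′ = J₂ − H₂d₂`).  For the class `(0 < 1, pp)`: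
`[edge] + rowFormC = boxSum(J¹(p₀)⊗J¹(p₁)⊗J⁰(p₂)) w₀₁ − boxSum(P¹(p₀)⊗P¹(p₁)⊗h(p₂)) (d2 w)`, by the eight bond terms of part 3b, the
componentwise grouping `(01)`: `P¹P¹P⁰ − P¹hJ⁰ + τh·J¹J⁰ + P¹·τh·J⁰ − hJ¹J⁰ = J¹J¹J⁰ − P¹P¹·cΔh`, `(02)`: `P¹(τP⁰ − P⁰)h = P¹·cΔP¹·h`,
`(12)`: `−(τP⁰ − P⁰)P¹h = −cΔP¹·P¹·h` — i.e. exactly `∂h = J¹ − P¹`, `h∂ = J⁰ − P⁰`, `∂P⁰ = P¹∂`.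

Elementary; nothing of Bałaban's is asserted.
-/

noncomputable section

open scoped BigOperators Matrix.Norms.L2Operator

namespace Summit.QuantumFields.YangMills.Theorems.ApproxLift.AnsatzT

open Literature.MathematicalPhysics.QuantumFieldTheory.Balaban1983to89
open T4Continuum BlockAveraging
open AnsatzS (P3 o01 o02 o12 sum_orient3)

/-! ## §1 Small complements to the box machinery -/

section BoxExtra

variable {M : Type*} [AddCommGroup M] [Module ℂ M]

/-- The zero coefficient function. -/
theorem boxSum_zero (W : (Fin 3 → ℤ) → M) : boxSum (fun _ _ _ => (0 : ℝ)) W = 0 := by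
  simp [boxSum]

/-- Members of the box have `|·| ≤ 2`. -/
theorem natAbs_le_of_mem_B2 {a : ℤ} (ha : a ∈ B2) : a.natAbs ≤ 1 + 1 := by
  simp only [B2, Finset.mem_Icc] at ha; omega

/-- The components of `![a,b,c]` on the box have `|·| ≤ 2`. -/
theorem natAbs_vec3_le {a b c : ℤ} (ha : a ∈ B2) (hb : b ∈ B2) (hc : c ∈ B2) (i : Fin 3) :
    ((![a, b, c] : Fin 3 → ℤ) i).natAbs ≤ 1 + 1 := by
  fin_cases i
  · exact natAbs_le_of_mem_B2 ha
  · exact natAbs_le_of_mem_B2 hb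
  · exact natAbs_le_of_mem_B2 hc

end BoxExtra

section NormExtra

variable {M : Type*} [SeminormedAddCommGroup M] [NormedSpace ℂ M]

/-- **NORM OF THE BOX FUNCTIONAL**, the field bounded on the box only. -/
theorem norm_boxSum_le' (F : ℤ → ℤ → ℤ → ℝ) {W : (Fin 3 → ℤ) → M} {Bw : ℝ}
    (hW : ∀ a b c, a ∈ B2 → b ∈ B2 → c ∈ B2 → ‖W ![a, b, c]‖ ≤ Bw) :
    ‖boxSum F W‖ ≤ (∑ a ∈ B2, ∑ b ∈ B2, ∑ c ∈ B2, |F a b c|) * Bw := by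
  unfold boxSum
  rw [Finset.sum_mul]
  refine (norm_sum_le _ _).trans (Finset.sum_le_sum fun a ha => ?_)
  rw [Finset.sum_mul]
  refine (norm_sum_le _ _).trans (Finset.sum_le_sum fun b hb => ?_)
  rw [Finset.sum_mul]
  refine (norm_sum_le _ _).trans (Finset.sum_le_sum fun c hc => ?_)
  rw [norm_smul, Complex.norm_real, Real.norm_eq_abs]
  exact mul_le_mul_of_nonneg_left (hW a b c ha hb hc) (abs_nonneg _)

end NormExtra

/-! ## §2 Masses of the kernels on the box -/

section Mass

variable {h p : ℕ}

/-- `Σ_{a ∈ box} |P⁰(p,a)| ≤ 1`. -/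
theorem mass_P0 (h p : ℕ) : ∑ a ∈ B2, |P0 h p a| ≤ 1 := by unfold P0; rw [sum_B2_abs_mk3]; simp [P0z]
/-- `Σ |P¹(p,a)| ≤ 1`. -/
theorem mass_P1 (h p : ℕ) : ∑ a ∈ B2, |P1 h p a| ≤ 1 := by
  unfold P1; rw [sum_B2_abs_mk3]; simp only [abs_zero, zero_add, add_zero, P1z]; split_ifs <;> simp
/-- `Σ |h(p,a)| ≤ 1`. -/
theorem mass_hh (hp : p ≤ 2 * h) : ∑ a ∈ B2, |hh h p a| ≤ 1 := by
  unfold hh; rw [sum_B2_abs_mk3]; simp only [abs_zero, add_zero]; exact abs_hh hp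
/-- `Σ |J⁰(p,a)| ≤ 2`. -/
theorem mass_J0 (hp : p ≤ 2 * h) : ∑ a ∈ B2, |J0 h p a| ≤ 2 := by unfold J0; rw [sum_B2_abs_mk3]; exact abs_J0 hp
/-- `Σ |J¹(p,a)| ≤ 3/L`. -/
theorem mass_J1 (h p : ℕ) : ∑ a ∈ B2, |J1 h p a| ≤ 3 / Lr h := by unfold J1; rw [sum_B2_abs_mk3]; exact abs_J1 p

/-- A product mass bound. -/
theorem boxMass_le {u v w : ℤ → ℝ} {A B C : ℝ} (hu : ∑ a ∈ B2, |u a| ≤ A) (hv : ∑ b ∈ B2, |v b| ≤ B) (hw : ∑ c ∈ B2, |w c| ≤ C) :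
    (∑ a ∈ B2, ∑ b ∈ B2, ∑ c ∈ B2, |u a * v b * w c|) ≤ A * B * C := by
  rw [boxMass_prod]
  have h0 : 0 ≤ ∑ a ∈ B2, |u a| := Finset.sum_nonneg fun _ _ => abs_nonneg _
  have h1 : 0 ≤ ∑ b ∈ B2, |v b| := Finset.sum_nonneg fun _ _ => abs_nonneg _
  have h2 : 0 ≤ ∑ c ∈ B2, |w c| := Finset.sum_nonneg fun _ _ => abs_nonneg _
  have hA : 0 ≤ A := h0.trans hu
  have hB : 0 ≤ B := h1.trans hv
  exact mul_le_mul (mul_le_mul hu hv h1 hA) hw h2 (mul_nonneg hA hB)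

end Mass

/-! ## §3 Orientation `(0,1)` -/

section Rows

variable {n : Type*} [Fintype n] [DecidableEq n]
variable {L m K : ℕ} {hL : Odd L ∧ 1 < L}

/-- `d2` against a box functional, in the cell's orientation names. -/
theorem boxSum_d2' (H : ℤ → ℤ → ℤ → ℝ) (w : Orient 3 → (Fin 3 → ℤ) → Matrix n n ℂ)
    (hA2 : ∀ b c, H 2 b c = 0) (hA3 : ∀ b c, H (-3) b c = 0) (hB2 : ∀ a c, H a 2 c = 0) (hB3 : ∀ a c, H a (-3) c = 0)
    (hC2 : ∀ a b, H a b 2 = 0) (hC3 : ∀ a b, H a b (-3) = 0) :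
    boxSum H (fun v => d2 w 0 1 2 o01.2 o12.2 v) =
      boxSum (fun a b c => H (a - 1) b c - H a b c) (w o12) - boxSum (fun a b c => H a (b - 1) c - H a b c) (w o02) +
      boxSum (fun a b c => H a b (c - 1) - H a b c) (w o01) :=
  boxSum_d2 H w o01.2 o12.2 hA2 hA3 hB2 hB3 hC2 hC3

/-- Values of `P¹ ⊗ P¹ ⊗ P⁰` on the corner line: the indicator of the origin. -/
theorem P1_P1_P0_corner (h : ℕ) (q : ℕ) (a b c : ℤ) :
    P1 h (2 * h) a * P1 h (2 * h) b * P0 h q c = if a = 0 ∧ b = 0 ∧ c = 0 then 1 else 0 := by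
  unfold P1 P0 mk3 P1z P0z
  by_cases ha : a = 0 <;> by_cases hb : b = 0 <;> by_cases hc : c = 0 <;> simp [ha, hb, hc]

/-- `P¹(p, ·) = 0` off the exit offset. -/
theorem P1_of_ne {h p : ℕ} (hp : p ≠ 2 * h) (a : ℤ) : P1 h p a = 0 := by
  unfold P1 mk3 P1z; simp [hp]

omit [Fintype n] [DecidableEq n] in
/-- **THE EDGE TERM AS A BOX FUNCTIONAL**, orientation `(0,1)`. -/
theorem edge01_eq (hodd : Odd L) (pp : Fin 3 → Fin L) (w : Orient 3 → (Fin 3 → ℤ) → Matrix n n ℂ) :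
    (if exbC (P := P3 L m K hL) pp 0 = true ∧ exbC (P := P3 L m K hL) pp 1 = true then w o01 0 else 0) =
      boxSum (fun a b c => P1 (L / 2) (pp 0) a * P1 (L / 2) (pp 1) b * P0 (L / 2) (pp 2) c) (w o01) := by
  have hodd' : 2 * (L / 2) + 1 = L := by obtain ⟨t, ht⟩ := hodd; omega
  by_cases e0 : ((pp 0 : Fin L) : ℕ) = L - 1
  · by_cases e1 : ((pp 1 : Fin L) : ℕ) = L - 1
    · have q : L - 1 = 2 * (L / 2) := by omega
      simp only [exbC, e0, e1, decide_true, and_self, if_true]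
      rw [boxSum_congr (w o01) (fun a b c _ _ _ => by rw [q, P1_P1_P0_corner]), boxSum_single, Complex.ofReal_one, one_smul]
    · simp only [exbC, e0, e1, decide_true, decide_false, Bool.false_eq_true, and_false, if_false]
      rw [boxSum_congr (w o01) (fun a b c _ _ _ => by rw [P1_of_ne (p := (pp 1 : ℕ)) (by omega) b, mul_zero, zero_mul]), boxSum_zero]
  · simp only [exbC, e0, decide_false, Bool.false_eq_true, false_and, if_false]
    rw [boxSum_congr (w o01) (fun a b c _ _ _ => by rw [P1_of_ne (p := (pp 0 : ℕ)) (by omega) a, zero_mul, zero_mul]), boxSum_zero]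

/-- **ROW `(0,1)` OF THE TENSOR TABLE**: `‖[edge] + rowFormC‖ ≤ (18/L²)·B_w + 1·B_d` (odd `L ≥ 3`). -/
theorem rowT01 (hodd : Odd L) (h3 : 3 ≤ L) (pp : Fin 3 → Fin L) (w : Orient 3 → (Fin 3 → ℤ) → Matrix n n ℂ) {Bw Bd : ℝ}
    (hw : ∀ o s, ‖w o s‖ ≤ Bw)
    (hd : ∀ s : Fin 3 → ℤ, (∀ i, (s i).natAbs ≤ 1 + 1) → ‖d2 w 0 1 2 o01.2 o12.2 s‖ ≤ Bd) (hBw : 0 ≤ Bw) (hBd : 0 ≤ Bd) :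
    ‖(if exbC (P := P3 L m K hL) pp 0 = true ∧ exbC (P := P3 L m K hL) pp 1 = true then w o01 0 else 0) +
        rowFormC (P := P3 L m K hL) 1 (kzT L) pp 0 1 w‖ ≤ (18 / (L : ℝ) ^ 2) * Bw + 1 * Bd := by
  set h := L / 2 with hdef
  have h1 : 1 ≤ h := by omega
  have hodd' : 2 * h + 1 = L := by obtain ⟨t, ht⟩ := hodd; omega
  have hp : ∀ i, ((pp i : Fin L) : ℕ) ≤ 2 * h := fun i => by have := (pp i).isLt; omega
  have hLr : Lr h = L := by unfold Lr; exact_mod_cast hodd'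
  -- the chain identities in the block size `L`
  have fh : ∀ (p : ℕ) (j : ℤ), p ≤ 2 * h → τ L (hh h) p j = hh h p j + (J1 h p j - P1 h p j) := fun p j hpj => by
    rw [τ_eq, ← hodd', fδ_hh h1 hpj]
  have fP : ∀ (p : ℕ) (j : ℤ), p ≤ 2 * h → τ L (P0 h) p j = P0 h p j + (P1 h p (j - 1) - P1 h p j) := fun p j hpj => by
    rw [τ_eq, ← hodd', fδ_P0 h1 hpj]; rfl
  have ch : ∀ (p : ℕ) (j : ℤ), hh h p (j - 1) = hh h p j + (J0 h p j - P0 h p j) := fun p j => by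
    have := cΔ_hh (h := h) (p := p) j; unfold cΔ at this; linarith
  -- supports of the kernels at `±2`, `−3`
  have o2 : (2:ℤ) ≤ |(2:ℤ)| := by norm_num
  have o3 : (2:ℤ) ≤ |(-3:ℤ)| := by norm_num
  -- Step A: expand the four bonds over the three orientations and convert every bond term to a box functional
  rw [rowFormC, edge01_eq (hL := hL) hodd]
  simp only [sum_orient3, kzT]
  rw [AnsatzS.succOff_ne pp (show (1 : Fin 3) ≠ 0 by decide), AnsatzS.succOff_ne pp (show (2 : Fin 3) ≠ 0 by decide),
    AnsatzS.succOff_ne pp (show (0 : Fin 3) ≠ 1 by decide), AnsatzS.succOff_ne pp (show (2 : Fin 3) ≠ 1 by decide),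
    AnsatzS.succOff_val_self, AnsatzS.succOff_val_self]
  simp (decide := true) only [tabT, Fin.isValue, Fin.val_zero, Fin.val_one, and_self, and_true, and_false,
    if_true, if_false, Complex.ofReal_neg, neg_smul, Finset.sum_neg_distrib, Complex.ofReal_zero, zero_smul,
    Finset.sum_const_zero, add_zero]
  rw [← hdef]
  rw [term_plain (KSupp.P1 h) (KSupp.hh h) (KSupp.J0 h), term_plain (KSupp.P1 h) (KSupp.P0 h) (KSupp.hh h),
    term_shift0 (hL := hL) (KSupp.hh h) (KSupp.J1 h) (KSupp.J0 h), term_shift0 (hL := hL) (KSupp.P0 h) (KSupp.P1 h) (KSupp.hh h),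
    term_shift1 (hL := hL) (KSupp.P1 h) (KSupp.hh h) (KSupp.J0 h), term_shift1 (hL := hL) (KSupp.P1 h) (KSupp.P0 h) (KSupp.hh h),
    term_plain (KSupp.hh h) (KSupp.J1 h) (KSupp.J0 h), term_plain (KSupp.P0 h) (KSupp.P1 h) (KSupp.hh h)]
  -- Step B: names for the nine box functionals and the two targets
  set E := boxSum (fun a b c => P1 h (pp 0) a * P1 h (pp 1) b * P0 h (pp 2) c) (w o01) with hE
  set B1a := boxSum (fun a b c => P1 h (pp 0) a * hh h (pp 1) b * J0 h (pp 2) c) (w o01) with hB1a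
  set B1b := boxSum (fun a b c => P1 h (pp 0) a * P0 h (pp 1) b * hh h (pp 2) c) (w o02) with hB1b
  set B2a := boxSum (fun a b c => τ L (hh h) (pp 0) a * J1 h (pp 1) b * J0 h (pp 2) c) (w o01) with hB2a
  set B2c := boxSum (fun a b c => τ L (P0 h) (pp 0) a * P1 h (pp 1) b * hh h (pp 2) c) (w o12) with hB2c
  set B3a := boxSum (fun a b c => P1 h (pp 0) a * τ L (hh h) (pp 1) b * J0 h (pp 2) c) (w o01) with hB3a
  set B3b := boxSum (fun a b c => P1 h (pp 0) a * τ L (P0 h) (pp 1) b * hh h (pp 2) c) (w o02) with hB3b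
  set B4a := boxSum (fun a b c => hh h (pp 0) a * J1 h (pp 1) b * J0 h (pp 2) c) (w o01) with hB4a
  set B4c := boxSum (fun a b c => P0 h (pp 0) a * P1 h (pp 1) b * hh h (pp 2) c) (w o12) with hB4c
  set BJ := boxSum (fun a b c => J1 h (pp 0) a * J1 h (pp 1) b * J0 h (pp 2) c) (w o01) with hBJ
  set BHD := boxSum (fun a b c => P1 h (pp 0) a * P1 h (pp 1) b * hh h (pp 2) c) (fun v => d2 w 0 1 2 o01.2 o12.2 v) with hBHD
  -- the `d2` functional expanded on the three components
  have hD : BHD = boxSum (fun a b c => P1 h (pp 0) (a - 1) * P1 h (pp 1) b * hh h (pp 2) c) (w o12)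
      - boxSum (fun a b c => P1 h (pp 0) a * P1 h (pp 1) b * hh h (pp 2) c) (w o12)
      - (boxSum (fun a b c => P1 h (pp 0) a * P1 h (pp 1) (b - 1) * hh h (pp 2) c) (w o02)
        - boxSum (fun a b c => P1 h (pp 0) a * P1 h (pp 1) b * hh h (pp 2) c) (w o02))
      + (boxSum (fun a b c => P1 h (pp 0) a * P1 h (pp 1) b * hh h (pp 2) (c - 1)) (w o01)
        - boxSum (fun a b c => P1 h (pp 0) a * P1 h (pp 1) b * hh h (pp 2) c) (w o01)) := by
    rw [hBHD, boxSum_d2' _ w (fun b c => by simp [KSupp.P1 h _ _ o2]) (fun b c => by simp [KSupp.P1 h _ _ o3])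
      (fun a c => by simp [KSupp.P1 h _ _ o2]) (fun a c => by simp [KSupp.P1 h _ _ o3])
      (fun a b => by simp [KSupp.hh h _ _ o2]) (fun a b => by simp [KSupp.hh h _ _ o3])]
    simp only [boxSum_sub]
  -- Step C: the three componentwise identities
  have g01 : E - B1a + B2a + B3a - B4a = BJ - (boxSum (fun a b c => P1 h (pp 0) a * P1 h (pp 1) b * hh h (pp 2) (c - 1)) (w o01)
        - boxSum (fun a b c => P1 h (pp 0) a * P1 h (pp 1) b * hh h (pp 2) c) (w o01)) := by
    have key := boxSum_congr (w o01)
      (F := fun a b c => P1 h (pp 0) a * P1 h (pp 1) b * P0 h (pp 2) c - P1 h (pp 0) a * hh h (pp 1) b * J0 h (pp 2) c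
        + τ L (hh h) (pp 0) a * J1 h (pp 1) b * J0 h (pp 2) c + P1 h (pp 0) a * τ L (hh h) (pp 1) b * J0 h (pp 2) c
        - hh h (pp 0) a * J1 h (pp 1) b * J0 h (pp 2) c)
      (G := fun a b c => J1 h (pp 0) a * J1 h (pp 1) b * J0 h (pp 2) c
        - (P1 h (pp 0) a * P1 h (pp 1) b * hh h (pp 2) (c - 1) - P1 h (pp 0) a * P1 h (pp 1) b * hh h (pp 2) c))
      (fun a b c _ _ _ => by rw [fh _ _ (hp 0), fh _ _ (hp 1), ch]; ring)
    simp only [boxSum_add, boxSum_sub] at key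
    rw [hE, hB1a, hB2a, hB3a, hB4a, hBJ]; exact key
  have g02 : -B1b + B3b = boxSum (fun a b c => P1 h (pp 0) a * P1 h (pp 1) (b - 1) * hh h (pp 2) c) (w o02)
        - boxSum (fun a b c => P1 h (pp 0) a * P1 h (pp 1) b * hh h (pp 2) c) (w o02) := by
    have key := boxSum_congr (w o02)
      (F := fun a b c => -(P1 h (pp 0) a * P0 h (pp 1) b * hh h (pp 2) c) + P1 h (pp 0) a * τ L (P0 h) (pp 1) b * hh h (pp 2) c)
      (G := fun a b c => P1 h (pp 0) a * P1 h (pp 1) (b - 1) * hh h (pp 2) c - P1 h (pp 0) a * P1 h (pp 1) b * hh h (pp 2) c)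
      (fun a b c _ _ _ => by rw [fP _ _ (hp 1)]; ring)
    simp only [boxSum_add, boxSum_sub, boxSum_neg] at key
    rw [hB1b, hB3b]; exact key
  have g12 : -B2c + B4c = -(boxSum (fun a b c => P1 h (pp 0) (a - 1) * P1 h (pp 1) b * hh h (pp 2) c) (w o12)
        - boxSum (fun a b c => P1 h (pp 0) a * P1 h (pp 1) b * hh h (pp 2) c) (w o12)) := by
    have key := boxSum_congr (w o12)
      (F := fun a b c => -(τ L (P0 h) (pp 0) a * P1 h (pp 1) b * hh h (pp 2) c) + P0 h (pp 0) a * P1 h (pp 1) b * hh h (pp 2) c)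
      (G := fun a b c => -(P1 h (pp 0) (a - 1) * P1 h (pp 1) b * hh h (pp 2) c - P1 h (pp 0) a * P1 h (pp 1) b * hh h (pp 2) c))
      (fun a b c _ _ _ => by rw [fP _ _ (hp 0)]; ring)
    simp only [boxSum_add, boxSum_sub, boxSum_neg] at key
    rw [hB2c, hB4c]; exact key
  have key : E - B1a - B1b + B2a - B2c + B3a + B3b - B4a + B4c = BJ - BHD := by
    rw [hD]
    calc E - B1a - B1b + B2a - B2c + B3a + B3b - B4a + B4c
        = (E - B1a + B2a + B3a - B4a) + (-B1b + B3b) + (-B2c + B4c) := by abel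
      _ = _ := by rw [g01, g02, g12]
      _ = _ := by abel
  -- Step D: the bound
  have hJ : ‖BJ‖ ≤ (18 / (L : ℝ) ^ 2) * Bw := by
    refine (norm_boxSum_le' _ (fun a b c _ _ _ => hw _ _)).trans (mul_le_mul_of_nonneg_right ?_ hBw)
    refine (boxMass_le (mass_J1 h _) (mass_J1 h _) (mass_J0 (hp 2))).trans (le_of_eq ?_)
    rw [hLr]; ring
  have hH : ‖BHD‖ ≤ 1 * Bd := by
    refine (norm_boxSum_le' _ (fun a b c ha hb hc => hd _ (natAbs_vec3_le ha hb hc))).trans (mul_le_mul_of_nonneg_right ?_ hBd)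
    refine (boxMass_le (mass_P1 h _) (mass_P1 h _) (mass_hh (hp 2))).trans (by norm_num)
  calc _ = ‖BJ - BHD‖ := congrArg _ (by rw [← key]; abel)
    _ ≤ ‖BJ‖ + ‖BHD‖ := norm_sub_le _ _
    _ ≤ (18 / (L : ℝ) ^ 2) * Bw + 1 * Bd := add_le_add hJ hH

end Rows

end Summit.QuantumFields.YangMills.Theorems.ApproxLift.AnsatzT

end
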